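import Summits.QuantumAdvantage.QuantumAdvantage.Theorems.SosSandwichPseudoBoundedAAChebyshevCalibration
import Summits.QuantumAdvantage.QuantumAdvantage.Theorems.SosSandwichHomogeneousPBAATExponentCorner

/-!
# Route `SosSandwich`, crux `PseudoBoundedAA` (stmt-QuantumAdvantage-15237) — the admissible exponent corner
of the SOS sandwich class is `(Var², T²)`

Helper (`--supports stmt-QuantumAdvantage-15237`), conjecture-free, no named facts. One citable theorem that
combines the two calibrations now in the tree. For influence laws with separate exponents on the FULL class
`K = ⋃_T K_T` (pseudo-bounded `p` of order `T ≥ 1`, `Var[p] > 0`),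

  `(a, b)`-law:  `∃ C > 0`, every such `p` has a variable with `Infᵢ[p] ≥ C · Var[p]^a / T^b`,

**every admissible pair has `a ≥ 2` and `b ≥ 2`** (`pseudoBounded_exponent_corner`, stated in the route file's
inline cube vocabulary, `let ev / let avg`):
* `a ≥ 2` — from `homogeneousRung_exponent_corner` (`SosSandwichHomogeneousPBAATExponentCorner.lean`,
  lineage g2: the mean-square family at `T = 1`; a law on `K` restricts to the top-homogeneous class);
* `b ≥ 2` — from `not_influence_law_linear_in_T` (`SosSandwichPseudoBoundedAAChebyshevCalibration.lean`,
  this lineage g3: the Chebyshev / amplitude-amplification family `T_k(ȳ)²` on `N = k²` variables has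
  `Var ≥ 1/2592` and every influence `≤ 29/k²`; for `b ≤ 1`, `T^b ≤ T` turns an `(a, b)`-law into the refuted
  linear-loss law).
So `maxInf ≥ C·Var²/T²` (the idea card's "(c, exponent of T) = (2, 2)") is the unique strongest candidate law on
`K` consistent with the tree; the single-exponent crux `PseudoBoundedAA` (`C·(ε/T)^c`) can only hold with
`c ≥ 2` (`pseudoBoundedAA_exponent_ge_two`, g2 — now forced from both sides). Honest label: a calibration (which
laws are refuted), not a proof of any law.

[cite: EscuderoGutierrez2023, Conj. 1.5, Thm. 1.6] [cite: BealsEtAl2001, §4]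
-/

set_option linter.dupNamespace false

noncomputable section

namespace Summit.QuantumAdvantage.QuantumAdvantage.Theorems.SosSandwich

open Finset
open Literature.Computability.QuantumComplexity

/-- **Admissible exponent corner on `K`: `a ≥ 2 ∧ b ≥ 2`.** If `C > 0` and every pseudo-bounded `p` of order
`T ≥ 1` with `Var[p] > 0` (in the route file's inline cube vocabulary) has a variable with
`Infᵢ[p] ≥ C·Var[p]^a/T^b`, then `2 ≤ a` and `2 ≤ b`. [folklore] -/
theorem pseudoBounded_exponent_corner (a b : ℕ) {C : ℝ} (hC : 0 < C)
    (h : ∀ (N T : ℕ) (p : MvPolynomial (Fin N) ℝ),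
      let ev : MvPolynomial (Fin N) ℝ → (Fin N → Bool) → ℝ :=
        fun f x => MvPolynomial.eval (fun k => if x k then (1 : ℝ) else 0) f
      let avg : ((Fin N → Bool) → ℝ) → ℝ := fun g => (∑ x : Fin N → Bool, g x) / (2 : ℝ) ^ N
      1 ≤ T →
      (∃ (m : ℕ) (q r : Fin m → MvPolynomial (Fin N) ℝ),
          (∀ j, (q j).totalDegree ≤ T ∧ (r j).totalDegree ≤ T) ∧
            ∀ x : Fin N → Bool, ev p x = ∑ j, ev (q j) x ^ 2 ∧ 1 - ev p x = ∑ j, ev (r j) x ^ 2) →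
      0 < (avg fun x => (ev p x - avg (ev p)) ^ 2) →
      ∃ i : Fin N, C * (avg fun x => (ev p x - avg (ev p)) ^ 2) ^ a / (T : ℝ) ^ b ≤
        (avg fun x => (ev p x - ev p (Function.update x i (!x i))) ^ 2)) :
    2 ≤ a ∧ 2 ≤ b := by
  constructor
  · -- restrict the law to the top-homogeneous class and use the `Var`-side corner
    exact (homogeneousRung_exponent_corner a b hC
      (fun N T p hT hpb _hLap hvar => h N T p hT hpb hvar)).1
  · -- `b ≤ 1` would give the refuted linear-loss law on `K`
    by_contra hb
    have hb1 : b ≤ 1 := by omega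
    apply not_influence_law_linear_in_T
    refine ⟨a, C, hC, fun N T p hT hpb hvar => ?_⟩
    obtain ⟨i, hi⟩ := h N T p hT hpb hvar
    refine ⟨i, le_trans ?_ hi⟩
    change C * boolVariance p ^ a / (T : ℝ) ≤ C * boolVariance p ^ a / (T : ℝ) ^ b
    have hT1 : (1 : ℝ) ≤ T := by exact_mod_cast hT
    have hTb : (T : ℝ) ^ b ≤ T := by
      calc (T : ℝ) ^ b ≤ (T : ℝ) ^ 1 := pow_le_pow_right₀ hT1 hb1
        _ = T := pow_one _
    exact div_le_div_of_nonneg_left (mul_nonneg hC.le (pow_nonneg (boolVariance_nonneg p) a))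
      (by positivity) hTb

end Summit.QuantumAdvantage.QuantumAdvantage.Theorems.SosSandwich

end
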